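import Summits.AtomisticToContinuum.FouriersLaw.Theses.LocalOhmBV
import Summits.AtomisticToContinuum.FouriersLaw.Theorems.ParityLiouvilleSeedWindowLimitTimeInvariance
import Summits.AtomisticToContinuum.FouriersLaw.Theorems.ParityLiouvilleSeedCesaroUpgradeGrowth

/-!
# The transported Liouville derivative of a bulk box observable: size, continuity, weak stationarity
# (smooth case)

Helper file for stub `stub_finiteResponsePackage` (S2a) of the birth line of crux `LocalOhmBV.LocalOhm`
(item stmt-AtomisticToContinuum-12009), clause (a3). For the pinned chain with ANY real parameters, a
box `{a, …, a + n}` read at the finite sites `a + c, …, a + c + n` through `WindowLimit.embed N c`: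

* `abs_liouvilleZ_comp_boxRestrictAt_embed_le` — `|𝒜(g ∘ box)(embed x)| ≤ ‖Dg(box(embed x))‖ (n + 1)
  (1 + 4 C_F)(1 + ‖x‖)³`, `C_F = |ω₂| + |lam| + 4 + 8|β|` (finite box sum `liouvilleZ_comp_boxRestrictAt`,
  cubic force bound `WindowLimit.pinnedChain_abs_force_le`);
* `continuous_liouvilleZ_comp_boxRestrictAt_embed`, `tendsto_liouvilleZ_comp_boxRestrictAt_embed` —
  continuity in `x` for `C¹` profiles, pointwise convergence from convergence of directional derivatives;
* `integral_liouvilleZ_embed_eq_zero_of_smooth` — for sites in `[1, N - 2]`, a SMOOTH profile with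
  `|g|, ‖Dg‖ ≤ C₀ (1 + ‖y‖)^m` and a finite measure weakly stationary on `C_c^∞` with all polynomial
  moments: `∫ 𝒜(g ∘ box)(embed N c x) dμ = 0` (the generator on a bulk-window observable is the Liouville
  operator, `WindowLimit.generator_comp_embed_eq_liouvilleZ`; weak stationarity on smooth polynomially
  bounded bulk observables, `WindowLimit.integral_generator_eq_zero_of_polyGrowth`).

The `C¹` case (dominated convergence with the mollification of the companion file Aux3) is assembled in
the stub file. No definitions.
-/

set_option autoImplicit false

noncomputable section

namespace Summit.AtomisticToContinuum.FouriersLaw.Theorems.LocalOhmBirth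

open MeasureTheory Filter Topology Set Metric Function
open scoped BigOperators ContDiff Convolution
open Literature.MathematicalPhysics.KineticTheory
open Literature.MathematicalPhysics.KineticTheory.HeatConduction
open Summit.AtomisticToContinuum.FouriersLaw.Theorems.WindowLimit

/-! ## The transported Liouville derivative of a box observable -/

section Transport

variable (ω₂ lam β γ : ℝ) {a : ℤ} {n N c : ℕ}

/-- **Size of the transported Liouville derivative**: with `C_F = |ω₂| + |lam| + 4 + 8|β|`, for a profile
`g` differentiable at the box point,
`|𝒜(g ∘ box)(embed x)| ≤ ‖Dg(box (embed x))‖ (n + 1)(1 + 4 C_F)(1 + ‖x‖)³`. [folklore] -/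
theorem abs_liouvilleZ_comp_boxRestrictAt_embed_le {g : (Fin (n + 1) → ℝ × ℝ) → ℝ} (x : PhaseSpace N)
    (hg : DifferentiableAt ℝ g (boxRestrictAt a n (embed N c x))) :
    |liouvilleZ (pinnedChain ω₂ lam β γ) (g ∘ boxRestrictAt a n) (embed N c x)| ≤
      ‖fderiv ℝ g (boxRestrictAt a n (embed N c x))‖ *
        (((n : ℝ) + 1) * (1 + 4 * (|ω₂| + |lam| + 4 + 8 * |β|)) * (1 + ‖x‖) ^ 3) := by
  set P := pinnedChain ω₂ lam β γ with hP
  set σ := embed N c x with hσ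
  set K : ℝ := ‖fderiv ℝ g (boxRestrictAt a n σ)‖ with hK
  set C_F : ℝ := |ω₂| + |lam| + 4 + 8 * |β| with hCF
  set s : ℝ := ‖x‖ with hs
  have hK0 : 0 ≤ K := norm_nonneg _
  have hCF0 : 0 ≤ C_F := by rw [hCF]; positivity
  have hs0 : 0 ≤ s := norm_nonneg _
  have h13 : (1 : ℝ) ≤ (1 + s) ^ 3 := one_le_pow₀ (by linarith)
  have hs3 : s ^ 3 ≤ (1 + s) ^ 3 := pow_le_pow_left₀ hs0 (by linarith) 3
  have hs1 : s ≤ (1 + s) ^ 3 := by nlinarith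
  rw [liouvilleZ_comp_boxRestrictAt P a n σ hg]
  -- the directional derivatives along unit coordinate vectors are bounded by `K`
  have hDv : ∀ v : Fin (n + 1) → ℝ × ℝ, ‖v‖ ≤ 1 → |fderiv ℝ g (boxRestrictAt a n σ) v| ≤ K := by
    intro v hv
    rw [← Real.norm_eq_abs]
    calc ‖fderiv ℝ g (boxRestrictAt a n σ) v‖ ≤ ‖fderiv ℝ g (boxRestrictAt a n σ)‖ * ‖v‖ :=
          ContinuousLinearMap.le_opNorm _ _
      _ ≤ K * 1 := mul_le_mul le_rfl hv (norm_nonneg _) hK0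
      _ = K := mul_one _
  have h1 : ∀ i : Fin (n + 1), ‖(Pi.single i ((1 : ℝ), (0 : ℝ)) : Fin (n + 1) → ℝ × ℝ)‖ ≤ 1 := fun i => by
    rw [Pi.norm_single]; simp [Prod.norm_def]
  have h2 : ∀ i : Fin (n + 1), ‖(Pi.single i ((0 : ℝ), (1 : ℝ)) : Fin (n + 1) → ℝ × ℝ)‖ ≤ 1 := fun i => by
    rw [Pi.norm_single]; simp [Prod.norm_def]
  -- coordinates and forces of the embedded configuration
  have hq3 : ∀ z : ℤ, |(σ z).1| ^ 3 ≤ s ^ 3 := fun z =>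
    pow_le_pow_left₀ (abs_nonneg _) (abs_embed_coord_le N c x z).1 3
  have hp : ∀ z : ℤ, |(σ z).2| ≤ (1 + s) ^ 3 := fun z => (abs_embed_coord_le N c x z).2.trans hs1
  have hF : ∀ z : ℤ, |P.force σ z| ≤ 4 * C_F * (1 + s) ^ 3 := by
    intro z
    refine (pinnedChain_abs_force_le ω₂ lam β γ σ z).trans ?_
    have := hq3 (z - 1); have := hq3 z; have := hq3 (z + 1)
    calc C_F * (1 + (|(σ (z - 1)).1| ^ 3 + |(σ z).1| ^ 3 + |(σ (z + 1)).1| ^ 3))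
        ≤ C_F * (4 * (1 + s) ^ 3) := mul_le_mul_of_nonneg_left (by linarith) hCF0
      _ = 4 * C_F * (1 + s) ^ 3 := by ring
  have hterm : ∀ i : Fin (n + 1),
      |(σ (a + i)).2 * fderiv ℝ g (boxRestrictAt a n σ) (Pi.single i (1, 0)) +
        P.force σ (a + i) * fderiv ℝ g (boxRestrictAt a n σ) (Pi.single i (0, 1))| ≤
      K * ((1 + 4 * C_F) * (1 + s) ^ 3) := by
    intro i
    calc _ ≤ |(σ (a + i)).2| * |fderiv ℝ g (boxRestrictAt a n σ) (Pi.single i (1, 0))| +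
          |P.force σ (a + i)| * |fderiv ℝ g (boxRestrictAt a n σ) (Pi.single i (0, 1))| := by
          rw [← abs_mul, ← abs_mul]; exact abs_add_le _ _
      _ ≤ (1 + s) ^ 3 * K + 4 * C_F * (1 + s) ^ 3 * K :=
          add_le_add (mul_le_mul (hp _) (hDv _ (h1 i)) (abs_nonneg _) (by positivity))
            (mul_le_mul (hF _) (hDv _ (h2 i)) (abs_nonneg _) (by positivity))
      _ = K * ((1 + 4 * C_F) * (1 + s) ^ 3) := by ring
  calc _ ≤ ∑ i : Fin (n + 1), |(σ (a + i)).2 * fderiv ℝ g (boxRestrictAt a n σ) (Pi.single i (1, 0)) +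
        P.force σ (a + i) * fderiv ℝ g (boxRestrictAt a n σ) (Pi.single i (0, 1))| :=
        Finset.abs_sum_le_sum_abs _ _
    _ ≤ ∑ _i : Fin (n + 1), K * ((1 + 4 * C_F) * (1 + s) ^ 3) := Finset.sum_le_sum fun i _ => hterm i
    _ = _ := by
        rw [Finset.sum_const, Finset.card_univ, Fintype.card_fin, nsmul_eq_mul]; push_cast; ring

/-- The transported Liouville derivative of a `C¹` box observable, written as a finite sum. [folklore] -/
theorem liouvilleZ_comp_boxRestrictAt_embed_eq_sum {g : (Fin (n + 1) → ℝ × ℝ) → ℝ}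
    (hg : Differentiable ℝ g) (x : PhaseSpace N) :
    liouvilleZ (pinnedChain ω₂ lam β γ) (g ∘ boxRestrictAt a n) (embed N c x) =
      ∑ i : Fin (n + 1), (((embed N c x) (a + i)).2 *
          fderiv ℝ g (boxRestrictAt a n (embed N c x)) (Pi.single i (1, 0)) +
        (pinnedChain ω₂ lam β γ).force (embed N c x) (a + i) *
          fderiv ℝ g (boxRestrictAt a n (embed N c x)) (Pi.single i (0, 1))) :=
  liouvilleZ_comp_boxRestrictAt _ a n _ (hg _)

/-- **Continuity of the transported Liouville derivative** of a `C¹` box observable. [folklore] -/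
theorem continuous_liouvilleZ_comp_boxRestrictAt_embed {g : (Fin (n + 1) → ℝ × ℝ) → ℝ}
    (hg : ContDiff ℝ 1 g) :
    Continuous fun x : PhaseSpace N =>
      liouvilleZ (pinnedChain ω₂ lam β γ) (g ∘ boxRestrictAt a n) (embed N c x) := by
  have hgd : Differentiable ℝ g := hg.differentiable one_ne_zero
  simp only [liouvilleZ_comp_boxRestrictAt_embed_eq_sum ω₂ lam β γ hgd]
  have hbox : Continuous fun x : PhaseSpace N => boxRestrictAt a n (embed N c x) :=
    (CesaroUpgrade.continuous_boxRestrictAt a n).comp (continuous_embed N c)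
  have hD : ∀ v : Fin (n + 1) → ℝ × ℝ,
      Continuous fun x : PhaseSpace N => fderiv ℝ g (boxRestrictAt a n (embed N c x)) v := fun v =>
    ((hg.continuous_fderiv one_ne_zero).comp hbox).clm_apply continuous_const
  refine continuous_finsetSum _ fun i _ => ?_
  refine ((continuous_snd.comp ((continuous_apply _).comp (continuous_embed N c))).mul (hD _)).add
    (((continuous_pinnedChain_force ω₂ lam β γ _).comp (continuous_embed N c)).mul (hD _))

/-- **Pointwise convergence of the transported Liouville derivatives** from pointwise convergence of
the directional derivatives of the profiles. [folklore] -/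
theorem tendsto_liouvilleZ_comp_boxRestrictAt_embed {g : (Fin (n + 1) → ℝ × ℝ) → ℝ}
    {gs : ℕ → (Fin (n + 1) → ℝ × ℝ) → ℝ} (hg : Differentiable ℝ g) (hgs : ∀ j, Differentiable ℝ (gs j))
    (hD : ∀ y v, Tendsto (fun j => fderiv ℝ (gs j) y v) atTop (𝓝 (fderiv ℝ g y v))) (x : PhaseSpace N) :
    Tendsto (fun j => liouvilleZ (pinnedChain ω₂ lam β γ) (gs j ∘ boxRestrictAt a n) (embed N c x)) atTop
      (𝓝 (liouvilleZ (pinnedChain ω₂ lam β γ) (g ∘ boxRestrictAt a n) (embed N c x))) := by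
  simp only [liouvilleZ_comp_boxRestrictAt_embed_eq_sum ω₂ lam β γ (hgs _),
    liouvilleZ_comp_boxRestrictAt_embed_eq_sum ω₂ lam β γ hg]
  refine tendsto_finsetSum _ fun i _ => ?_
  exact ((hD _ _).const_mul _).add ((hD _ _).const_mul _)

end Transport

/-! ## Weak stationarity of the transported Liouville derivative -/

section Stationarity

/-- **The smooth case**: for a smooth profile `g` with `|g|, ‖Dg‖ ≤ C₀ (1 + ‖y‖)^m` on a box read at the
finite sites `a + c, …, a + c + n ∈ [1, N - 2]`, and a finite measure `μ` that is weakly stationary on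
`C_c^∞` (for the pinned chain with ANY real parameters and any bath temperatures) with all polynomial
moments, `∫ 𝒜(g ∘ box)(embed N c x) dμ = 0`: the generator on the bulk-window observable is the
Liouville operator, and weak stationarity extends to smooth polynomially bounded bulk observables.
[folklore] -/
theorem integral_liouvilleZ_embed_eq_zero_of_smooth :
    ∀ (ω₂ lam β γ T_L T_R : ℝ) (a : ℤ) (n N c : ℕ), 1 ≤ a + c → a + c + n + 2 ≤ N →
    ∀ μ : Measure (PhaseSpace N), IsFiniteMeasure μ →
    (∀ f : PhaseSpace N → ℝ, ContDiff ℝ ((⊤ : ENat) : WithTop ENat) f → HasCompactSupport f →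
      ∫ x, (pinnedChain ω₂ lam β γ).generator N T_L T_R f x ∂μ = 0) →
    (∀ K : ℕ, Integrable (fun x : PhaseSpace N => (1 + ‖x‖) ^ K) μ) →
    ∀ g : (Fin (n + 1) → ℝ × ℝ) → ℝ, ContDiff ℝ ((⊤ : ENat) : WithTop ENat) g → ∀ (C₀ : ℝ) (m : ℕ),
      (∀ y, |g y| ≤ C₀ * (1 + ‖y‖) ^ m) → (∀ y, ‖fderiv ℝ g y‖ ≤ C₀ * (1 + ‖y‖) ^ m) →
      ∫ x, liouvilleZ (pinnedChain ω₂ lam β γ) (g ∘ boxRestrictAt a n)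
        (Summit.AtomisticToContinuum.FouriersLaw.Theorems.WindowLimit.embed N c x) ∂μ = 0 := by
  intro ω₂ lam β γ T_L T_R a n N c hc hN μ hfin hweak hmom g hg C₀ m hgb hDb
  haveI := hfin
  set P := pinnedChain ω₂ lam β γ with hP
  have hU : ContDiff ℝ ∞ P.U := pinnedChain_contDiff_U ω₂ lam β γ
  have hV : ContDiff ℝ ∞ P.V := pinnedChain_contDiff_V ω₂ lam β γ
  have hUd : Differentiable ℝ P.U := hU.differentiable (by simp)
  have hVd : Differentiable ℝ P.V := hV.differentiable (by simp)
  have hC₀ : 0 ≤ C₀ := by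
    have h := (abs_nonneg _).trans (hgb 0)
    exact nonneg_of_mul_nonneg_left h (by positivity)
  have h0c : (0 : ℤ) ≤ a + c := by omega
  have hNc : a + c + n < N := by omega
  set w : PhaseSpace N → ℝ := (g ∘ boxRestrictAt a n) ∘ embed N c with hw
  have hfw : ∀ x, liouvilleZ P (g ∘ boxRestrictAt a n) (embed N c x) = P.generator N T_L T_R w x :=
    fun x => (generator_comp_embed_eq_liouvilleZ P hUd hVd T_L T_R hc hN g x).symm
  have hws : ContDiff ℝ ∞ w := contDiff_comp_embed h0c hNc hg
  have h0 : ∀ i : Fin N, i.val = 0 → ∀ x, partialP i w x = 0 := fun i hi x =>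
    partialP_comp_embed_eq_zero_of_bath hc hN g i (Or.inl hi) x
  have h1 : ∀ i : Fin N, i.val = N - 1 → ∀ x, partialP i w x = 0 := fun i hi x =>
    partialP_comp_embed_eq_zero_of_bath hc hN g i (Or.inr hi) x
  -- growth bounds, common exponent `m + 3`
  set Kn : ℝ := ((n : ℝ) + 1) * (1 + 4 * (|ω₂| + |lam| + 4 + 8 * |β|)) with hKn
  have hKn0 : 0 ≤ Kn := by rw [hKn]; positivity
  set C : ℝ := max C₀ (C₀ * Kn) with hCdef
  have hmono : ∀ x : PhaseSpace N, (1 + ‖x‖) ^ m ≤ (1 + ‖x‖) ^ (m + 3) := fun x =>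
    pow_le_pow_right₀ (le_add_of_nonneg_right (norm_nonneg _)) (Nat.le_add_right m 3)
  have hbox : ∀ x : PhaseSpace N, (1 + ‖boxRestrictAt a n (embed N c x)‖) ^ m ≤ (1 + ‖x‖) ^ m := fun x =>
    pow_le_pow_left₀ (by positivity) (add_le_add le_rfl (norm_boxRestrictAt_embed_le h0c hNc x)) m
  have hwb : ∀ x, |w x| ≤ C * (1 + ‖x‖) ^ (m + 3) := by
    intro x
    calc |w x| = |g (boxRestrictAt a n (embed N c x))| := rfl
      _ ≤ C₀ * (1 + ‖boxRestrictAt a n (embed N c x)‖) ^ m := hgb _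
      _ ≤ C₀ * (1 + ‖x‖) ^ (m + 3) := mul_le_mul_of_nonneg_left ((hbox x).trans (hmono x)) hC₀
      _ ≤ C * (1 + ‖x‖) ^ (m + 3) := mul_le_mul_of_nonneg_right (le_max_left _ _) (by positivity)
  have hLw : ∀ x, |P.generator N T_L T_R w x| ≤ C * (1 + ‖x‖) ^ (m + 3) := by
    intro x
    rw [← hfw x]
    have hd : DifferentiableAt ℝ g (boxRestrictAt a n (embed N c x)) :=
      (hg.differentiable (by simp)) _
    calc _ ≤ ‖fderiv ℝ g (boxRestrictAt a n (embed N c x))‖ * (Kn * (1 + ‖x‖) ^ 3) :=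
          abs_liouvilleZ_comp_boxRestrictAt_embed_le ω₂ lam β γ x hd
      _ ≤ (C₀ * (1 + ‖x‖) ^ m) * (Kn * (1 + ‖x‖) ^ 3) :=
          mul_le_mul_of_nonneg_right ((hDb _).trans (mul_le_mul_of_nonneg_left (hbox x) hC₀))
            (by positivity)
      _ = (C₀ * Kn) * (1 + ‖x‖) ^ (m + 3) := by ring
      _ ≤ C * (1 + ‖x‖) ^ (m + 3) := mul_le_mul_of_nonneg_right (le_max_right _ _) (by positivity)
  have hz := integral_generator_eq_zero_of_polyGrowth P hU hV T_L T_R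
    (fun i x => pinnedChain_abs_partialQ_hamiltonian_le ω₂ lam β γ x i) μ hweak hmom hws h0 h1 hwb hLw
  simp only [hfw]
  exact hz

end Stationarity

end Summit.AtomisticToContinuum.FouriersLaw.Theorems.LocalOhmBirth

end
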